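import Summits.ABC.IUTFork.Cor312ThetaLocalLeContentHull
import Summits.ABC.IUTFork.Cor312PilotIdelesPrCapstone
import Summits.ABC.IUTFork.Cor312ThetaSideReduction
import HarnessLib

/-!
# [IUTchIII] Corollary 3.12 at the print-normalised assembled real setting — the Θ-SIDE CONTENT BOUND:
# `−|log(Θ)|_{i+1,p} ≤ Σ_{v⃗} Pr(v⃗)·(−m(v⃗)·log p + log μ̄(hull(log_p(R_{v⃗}^×))))` and the global
# `−|log(Θ)| ≤ Σ_{p∈T} (1/ℓ⋆)·Σ_i Σ_{v⃗} … + A` (G1-Θ units (U1)-HULL + (A) + (V) + (R) assembled, ANY base field)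

PROOF-ONLY support file (D-0012; no definitions, no `Prop` facts) of the abc-iut cell (R2 S-chain team, seat abc-iut-s2-p7,
TARGET #2 `hΘ` = the READ binder «(setting of the datum).negLogTheta ≤ ↑(genuine −|log(Θ)|)» of `Conditional/AbcOfS*.lean`;
G1-Θ SHAPES `HOME/staging/w5/w5-d166/g4/G1-THETA-SHAPES.md` units (U1)/(A)/(V)/(R)). TAKES NO SIDE on [IUTchIII] Cor. 3.12.

abc-iut-c312-7's `Real.settingPrVolSharp X hlog …` (`Cor312PilotIdelesPr`, p422627) is [IUTchIII] Cor. 3.12's setting over the REAL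
log-shells of the field of the pilot data `X : PilotData F` — ALL places of `F` over each `p`, packet-normalised volumes
(Dupuy–Hilado §3.6 `Pr(v⃗) = Π_a n_{v_a}/[F:ℚ]^{j+1}`), sharp Dupuy–Hilado Θ-boxes `ι_j(t_{Θ,j,v_j})·(R_I)^∼` read off Θ-ideles `t`
(§3.9, §4.10). Its `−|log(Θ)|` was so far only bounded BELOW (`neg_ndegLgp_le_negLogTheta_settingPrVolSharp`, c312-7) and, above,
by radii (abc-iut-w4-d107 `Cor312NegLogThetaUpperPrVolLocal`, abc-iut-s2-p6 `Cor312ThetaLocalUpperPrVolTuple`: `log(p²R/r)`-slack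
forms). THIS FILE instantiates the generic CONTENT bound of `Cor312ThetaLocalLeContentHull` (this seat):

* §1 `thetaLocal_settingPrVol_inl_eq_zero` — unit (A): at `v_ℚ = ∞` the local Θ-term of `settingPrVol` is `0` (trivial archimedean
  container of abc-iut-c312-5/c312-1; `hullDefined_settingPrVol_inl`, `logvol_situationPrVol_inl`);
* §2 **`thetaLocal_settingPrVol_untopD_le_sum_content_hull`** — unit (U1), ANY summand box family `B` (under `BridgeHyps`): if
  `B_{p,i+1,v⃗} ⊆ p^{m(v⃗)}·log_p(R_{v⃗}^×)` for a capsule-symmetric `m`, then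
  `−|log(Θ)|_{i+1,p} ≤ Σ_{v⃗} Pr(v⃗)·(−m(v⃗)·log p + log μ̄_{v⃗}(hull(log_p(R_{v⃗}^×))))` (hframe by `rfl`, hvol by abc-iut-c312-5
  `SummandPieces.logvol_preimage_pi`); **`thetaLocal_settingPrVolSharp_untopD_le_sum_content_hull`** — at the SHARP boxes, with
  `BridgeHyps` a THEOREM (c312-7 `bridgeHyps_settingPrVolSharp_of_ideles`), the hypothesis being the SLOT containment
  `ι_a(t_{Θ,i+1,v_a})·(R_I)^∼ ⊆ p^{m(v⃗)}·log_p(R_{v⃗}^×)` for all slots `a` — verbatim the `hm` of abc-iut-c312-3's exact genuine number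
  `negLogThetaDH_ofInput_eq_of_content` (`LDHGenuineExactVolume`);
* §3 **`negLogTheta_settingPrVolSharp_le_sum_content_hull`** — units (V)+(R): for any finite set `T` of primes containing the divisors
  of `2·disc(F)` and the primes under `S`, any symmetric content family on `T`, any `A ≥ 0`:
  `−|log(Θ)| ≤ ↑(Σ_{p∈T} (1/ℓ⋆)·Σ_i Σ_{v⃗} Pr(v⃗)·(−m·log p + log μ̄(hull(log_p R^×))) + A)` (off `T`: c312-7 `thetaLocal_settingPrVol_eq_zero`,
  [IUTchIV] Thm. 1.10 Step (vi); sum swap: abc-iut-w5-d166 `negLogTheta_le_sum_add`).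
USE: at `X := pilotDataOfK` over `K` (C-R16 R1 / C-R19 v5K) this is the setting-side half of `hΘ`; the remaining steps are the
Galois fibre-descent `Σ_{w⃗} Pr_K = Σ_{v⃗} Pr_{F_mod}` (abc-iut-w5-d004 p432683, abc-iut-w5-d056 p435649) and the same-place
identification with abc-iut-S2's `I.negLogThetaNonarch` + `A := archLogTheta l` ([IUTchIV] Step (vii)). At the M-level setting
(route β) the generic theorem is consumed directly (unit P6).
[cite: Mochizuki2012, IUTchIII Cor. 3.12 p. 173–174] [cite: Mochizuki2012, IUTchIV Thm. 1.10 Steps (v)–(viii) p. 27–30]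
[cite: DupuyHilado2025, §3.6, §3.9, §4.9, §4.12] [claim: Mochizuki2012, status: disputed] for every quoted construction.
HONEST FRAMING: an UPPER bound on OUR typed `−|log(Θ)|` at ONE instantiation (sharp (Ind3) reading, DH-level (Ind1)/(Ind2),
trivial archimedean container); nothing here asserts or denies Cor. 3.12 for any initial Θ-data or takes a side on any author;
typed ≠ proved; instantiated ≠ endorsed.
-/

noncomputable section

open Set Function NumberField IsDedekindDomain
open scoped Pointwise

namespace Summit.ABC

namespace IUTFork

namespace Thm311

namespace Real

open Cor312 Cor312Vol Literature.IUT.LogThetaLattice Literature.IUT.LogVolume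

variable {F : Type} [Field F] [NumberField F] (X : PilotData F) {logv : PadicLogs F} (hlog : LogvAnalytic logv)
  (M : Type) [Field M] [NumberField M]
  (archPk : ∀ (j : (thetaIndex X).Label) (vQ : (thetaIndex X).VQ), Set ((logShellsDH X logv).Packet j vQ))
  (archSub : ∀ (j : (thetaIndex X).Label) (v : (thetaIndex X).V),
    Set ((logShellsDH X logv).Packet j ((thetaIndex X).over v)))
  (Ψ : ℤ → ∀ v : (thetaIndex X).V, v ∈ (thetaIndex X).Vbad → Set ((logShellsDH X logv).StarPacket v))
  (act : ℤ → ∀ v : (thetaIndex X).V, v ∈ (thetaIndex X).Vbad →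
    (logShellsDH X logv).StarPacket v → Module.End ℚ ((logShellsDH X logv).StarPacket v))
  (Mmod : ℤ → ∀ j : (thetaIndex X).LabelStar, Set ((logShellsDH X logv).GlobalPacket j.1))
  (region : ℤ → ∀ j : (thetaIndex X).LabelStar, FinDivisor M → ∀ vQ : (thetaIndex X).VQ,
    Set ((logShellsDH X logv).Packet j.1 vQ))
  (n : ℤ) {HT : Type} {LogLink : HT → HT → Type} {IsFull : ∀ {s t : HT}, LogLink s t → Prop}
  (lat : LGPGaussianLogThetaLattice LogLink IsFull)
  {Frd : Type} {IsoF : Frd → Frd → Type} {Ob : Frd → Type} {realify : Frd → Frd} {Strip : Type}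
  {IsoS : Strip → Strip → Type} {Mv : ∀ v : (thetaIndex X).V, v ∈ (thetaIndex X).Vbad → Type}
  [∀ v h, Monoid (Mv v h)]
  (sig : GlobalLGPFrobenioidSignature (thetaIndex X).lstar (thetaIndex X).V (· ∈ (thetaIndex X).Vbad)
    Frd IsoF Ob realify Strip IsoS Mv)
  (split : SplittingMonoids Mv) {ObΔ : Type} {N : ∀ v : (thetaIndex X).V, v ∈ (thetaIndex X).Vbad → Type}
  [∀ v h, Monoid (N v h)] (qData : QPilotData ObΔ N)

/-! ## §1. Unit (A): the local Θ-term vanishes at the archimedean place; §2. unit (U1) for any box family -/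

section Boxes

variable
  (thetaBox : ℤ → Ob sig.Clgp → ∀ (j : (thetaIndex X).Label) (vQ : (thetaIndex X).VQ),
    Set (∀ s : factorIdxDH X hlog j vQ, factorFieldDH X hlog j vQ s))
  (qCentre : ObΔ → ∀ (j : (thetaIndex X).Label) (vQ : (thetaIndex X).VQ),
    ∀ s : factorIdxDH X hlog j vQ, factorFieldDH X hlog j vQ s)
  (hq : ∀ j vQ s, qCentre (qPilotObject qData) j vQ s ≠ 0)
  (hfin : ∀ j : (thetaIndex X).Label, (Function.support fun vQ =>
    ((situationPrVol X hlog M archPk archSub Ψ act Mmod region).D n).logvol j vQ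
      (factorMapDH X hlog j vQ ⁻¹' hullSet (factorFieldDH X hlog j vQ) (qCentre (qPilotObject qData) j vQ))).Finite)

/-- **Unit (A): at `v_ℚ = ∞` the local Θ-term of `settingPrVol` is `0`** — the hull is defined there unconditionally
(abc-iut-c312-7 `hullDefined_settingPrVol_inl`) and every region of the trivial archimedean container has log-volume `0`
(`logvol_situationPrVol_inl`). The genuine `−|log(Θ)|` carries instead the archimedean summand `((l+5)/4)·log π > 0` of
[IUTchIV] Thm. 1.10 Step (vii) (abc-iut-S2 `archLogTheta`), whence only `≤` in `hΘ`. [cite: Mochizuki2012, IUTchIV Thm. 1.10 Step (vii) p. 30] -/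
theorem thetaLocal_settingPrVol_inl_eq_zero (j : (thetaIndex X).Label) (u : Unit) :
    (settingPrVol X hlog M archPk archSub Ψ act Mmod region n lat sig split qData thetaBox qCentre hq hfin).thetaLocal j
        (.inl u) = ((0 : ℝ) : WithTop ℝ) := by
  unfold Cor312.Setting.thetaLocal
  rw [if_pos (hullDefined_settingPrVol_inl X hlog M archPk archSub Ψ act Mmod region n lat sig split qData thetaBox qCentre
    hq hfin j u)]
  exact congrArg _ (logvol_situationPrVol_inl X hlog M archPk archSub Ψ act Mmod region n u j _)

variable (B : ∀ (pp : Nat.Primes) (j : (thetaIndex X).Label)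
    (e : (thetaIndex X).Caps j → (thetaIndex X).Fibre (.inr pp)),
    haveI : Fact (pp : ℕ).Prime := ⟨pp.2⟩; Set ((presAt X hlog pp).X e))

/-- **Unit (U1) at `settingPrVol` with ANY summand box family `B`** (under abc-iut-c312-6's `BridgeHyps`): if every box at
`(i+1, p)` lies in `p^{m(v⃗)}·log_p(R_{v⃗}^×)` for a capsule-symmetric exponent `m`, then
`−|log(Θ)|_{i+1,p} ≤ Σ_{v⃗} Pr(v⃗)·(−m(v⃗)·log p + log μ̄_{v⃗}(hull(log_p(R_{v⃗}^×))))` — this seat's generic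
`thetaLocal_untopD_le_sum_content_hull` with `hframe := rfl` (the setting's frame IS the pulled-back real frame of the
presentation) and `hvol :=` abc-iut-c312-5's `SummandPieces.logvol_preimage_pi` (the line carries the probability-weighted container).
[cite: Mochizuki2012, IUTchIV Thm. 1.10 Step (v) p. 27–28] -/
theorem thetaLocal_settingPrVol_untopD_le_sum_content_hull
    (H : BridgeHyps (settingPrVol X hlog M archPk archSub Ψ act Mmod region n lat sig split qData
      (fun _ _ => thetaBoxDH X hlog B) qCentre hq hfin))
    (i : Fin (thetaIndex X).lstar) (pp : Nat.Primes)
    (m : ((thetaIndex X).Caps (Setting.labelSucc i) → (thetaIndex X).Fibre (.inr pp)) → ℤ)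
    (hm : ∀ (σ : Equiv.Perm ((thetaIndex X).Caps (Setting.labelSucc i)))
      (e : (thetaIndex X).Caps (Setting.labelSucc i) → (thetaIndex X).Fibre (.inr pp)), m (e ∘ σ) = m e)
    (hB : ∀ e : (thetaIndex X).Caps (Setting.labelSucc i) → (thetaIndex X).Fibre (.inr pp),
      haveI : Fact (pp : ℕ).Prime := ⟨pp.2⟩
      B pp (Setting.labelSucc i) e ⊆ (((pp : ℕ) : ℚ_[pp]) ^ m e) •
        (logPacket pp.1 ((presAt X hlog pp).kk e) : Set ((presAt X hlog pp).X e))) :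
    haveI : Fact (pp : ℕ).Prime := ⟨pp.2⟩
    ((settingPrVol X hlog M archPk archSub Ψ act Mmod region n lat sig split qData (fun _ _ => thetaBoxDH X hlog B)
        qCentre hq hfin).thetaLocal (Setting.labelSucc i) (.inr pp)).untopD 0 ≤
      ∑ e : (presAt X hlog pp).toLocalPieces.E (Setting.labelSucc i),
        weightPr X pp.1 (Setting.labelSucc i) e * (-(m e * Real.log pp) +
          packetLogμ pp.1 ((presAt X hlog pp).kk e)
            (packetHull pp.1 ((presAt X hlog pp).kk e)
              (logPacket pp.1 ((presAt X hlog pp).kk e) : Set ((presAt X hlog pp).X e)))) := by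
  haveI : Fact (pp : ℕ).Prime := ⟨pp.2⟩
  letI : Fintype ((thetaIndex X).Caps (Setting.labelSucc i) → (thetaIndex X).Fibre (.inr pp)) := Fintype.ofFinite _
  letI : Fintype ((presAtPr X hlog pp).factorIdx (Setting.labelSucc i)) :=
    factorIdxDH_fintype X hlog (Setting.labelSucc i) (.inr pp)
  have h3 : (settingPrVol X hlog M archPk archSub Ψ act Mmod region n lat sig split qData (fun _ _ => thetaBoxDH X hlog B)
      qCentre hq hfin).thetaRegion3 (Setting.labelSucc i) (.inr pp) ⊆
      (presAtPr X hlog pp).comparison (Setting.labelSucc i) ⁻¹' Set.pi univ fun e =>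
        (((pp : ℕ) : ℚ_[pp]) ^ m e) • (logPacket pp.1 ((presAtPr X hlog pp).kk e) : Set ((presAtPr X hlog pp).X e)) := by
    rw [thetaRegion3_thetaBoxDH_Pr]
    change (fun x => (presAtPr X hlog pp).factorMap (Setting.labelSucc i) x) ⁻¹'
      (presAtPr X hlog pp).boxOf (B pp (Setting.labelSucc i)) ⊆ _
    rw [(presAtPr X hlog pp).factorMap_preimage_boxOf]
    exact Set.preimage_mono (Set.pi_mono fun e _ => hB e)
  -- `hframe`: the setting's frame IS the pulled-back real frame of the presentation (definitionally)
  have hframe : (settingPrVol X hlog M archPk archSub Ψ act Mmod region n lat sig split qData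
      (fun _ _ => thetaBoxDH X hlog B) qCentre hq hfin).frame (Setting.labelSucc i) (.inr pp) =
      HullFrame.ofComparison ((presAtPr X hlog pp).factorField (Setting.labelSucc i))
        (fun x => (presAtPr X hlog pp).factorMap (Setting.labelSucc i) x) := rfl
  -- `hvol`: the line carries the probability-weighted container (abc-iut-c312-5 `logvol_preimage_pi`)
  have hvol : ∀ R : ∀ e : (thetaIndex X).Caps (Setting.labelSucc i) → (thetaIndex X).Fibre (.inr pp),
      Set ((presAtPr X hlog pp).X e),
      (∀ e, PacketAdm pp.1 ((presAtPr X hlog pp).kk e) (R e)) →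
        ((situationPrVol X hlog M archPk archSub Ψ act Mmod region).D n).logvol (Setting.labelSucc i) (.inr pp)
          ((presAtPr X hlog pp).comparison (Setting.labelSucc i) ⁻¹' Set.pi univ R) =
        ∑ e, (presAtPr X hlog pp).w (Setting.labelSucc i) e * packetLogμ pp.1 ((presAtPr X hlog pp).kk e) (R e) :=
    fun R hR => ((realizes_situationPrVol X hlog M archPk archSub Ψ act Mmod region n).logvol_eq _ (.inr pp) _).trans
      (SummandPieces.logvol_preimage_pi (summandPiecesPr X hlog) _ (.inr pp) hR)
  -- the generic content-hull bound, all implicit arguments supplied (elaboration order)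
  have key := @thetaLocal_untopD_le_sum_content_hull (thetaIndex X)
    (situationPrVol X hlog M archPk archSub Ψ act Mmod region)
    (settingPrVol X hlog M archPk archSub Ψ act Mmod region n lat sig split qData (fun _ _ => thetaBoxDH X hlog B)
      qCentre hq hfin) (.inr pp) pp.1 ⟨pp.2⟩ (presAtPr X hlog pp) H i _ _ hframe hvol m hm h3
  exact key

end Boxes

/-! ## §2 (sharp). Unit (U1) at `settingPrVolSharp`: the slot containment is the only hypothesis -/

section Sharp

variable (t : ∀ (pp : Nat.Primes) (_ : Fin X.lstar) (x : (thetaIndex X).Fibre (.inr pp)),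
    haveI : Fact (pp : ℕ).Prime := ⟨pp.2⟩; kOf X pp.1 x)
  (tq : ∀ (pp : Nat.Primes) (x : (thetaIndex X).Fibre (.inr pp)), haveI : Fact (pp : ℕ).Prime := ⟨pp.2⟩; kOf X pp.1 x)

/-- **Unit (U1) at the SHARP setting `settingPrVolSharp`**: for every capsule-symmetric exponent family `m` with the SLOT
containment `ι_a(t_{Θ,i+1,v_a})·(R_I)^∼ ⊆ p^{m(v⃗)}·log_p(R_{v⃗}^×)` at every slot `a` of every summand `v⃗` over `p` (the `hm` of
abc-iut-c312-3's `negLogThetaDH_ofInput_eq_of_content`; the CONTENT of the slot union is the largest such `m`),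
`−|log(Θ)|_{i+1,p} ≤ Σ_{v⃗} Pr(v⃗)·(−m(v⃗)·log p + log μ̄_{v⃗}(hull(log_p(R_{v⃗}^×))))` — `BridgeHyps` being a THEOREM here (abc-iut-c312-7
`bridgeHyps_settingPrVolSharp_of_ideles`), the idele binders `t ≠ 0`, `‖t‖ = 1` off `S`, `tq ≠ 0`, `‖tq‖ = 1` off `S` are the only
other inputs. [cite: Mochizuki2012, IUTchIV Thm. 1.10 Step (v) p. 27–28] [cite: DupuyHilado2025, §4.9, §4.12] -/
theorem thetaLocal_settingPrVolSharp_untopD_le_sum_content_hull (ht0 : ∀ pp i x, t pp i x ≠ 0)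
    (ht1 : ∀ (pp : Nat.Primes) (i : Fin X.lstar) (x : (thetaIndex X).Fibre (.inr pp)),
      haveI : Fact (pp : ℕ).Prime := ⟨pp.2⟩; placeOf X pp.1 x ∉ X.S → ‖t pp i x‖ = 1)
    (htq0 : ∀ pp x, tq pp x ≠ 0)
    (htq1 : ∀ (pp : Nat.Primes) (x : (thetaIndex X).Fibre (.inr pp)),
      haveI : Fact (pp : ℕ).Prime := ⟨pp.2⟩; placeOf X pp.1 x ∉ X.S → ‖tq pp x‖ = 1)
    (i : Fin (thetaIndex X).lstar) (pp : Nat.Primes)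
    (m : ((thetaIndex X).Caps (Setting.labelSucc i) → (thetaIndex X).Fibre (.inr pp)) → ℤ)
    (hm : ∀ (σ : Equiv.Perm ((thetaIndex X).Caps (Setting.labelSucc i)))
      (e : (thetaIndex X).Caps (Setting.labelSucc i) → (thetaIndex X).Fibre (.inr pp)), m (e ∘ σ) = m e)
    (hslot : ∀ (e : (thetaIndex X).Caps (Setting.labelSucc i) → (thetaIndex X).Fibre (.inr pp))
      (a : (thetaIndex X).Caps (Setting.labelSucc i)),
      haveI : Fact (pp : ℕ).Prime := ⟨pp.2⟩
      iota pp.1 ((presAt X hlog pp).kk e) a (t pp i (e a)) •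
          (normalizedPacket pp.1 ((presAt X hlog pp).kk e) : Set ((presAt X hlog pp).X e)) ⊆
        (((pp : ℕ) : ℚ_[pp]) ^ m e) • (logPacket pp.1 ((presAt X hlog pp).kk e) : Set ((presAt X hlog pp).X e))) :
    haveI : Fact (pp : ℕ).Prime := ⟨pp.2⟩
    ((settingPrVolSharp X hlog M archPk archSub Ψ act Mmod region n lat sig split qData tq t htq0 htq1).thetaLocal
        (Setting.labelSucc i) (.inr pp)).untopD 0 ≤
      ∑ e : (presAt X hlog pp).toLocalPieces.E (Setting.labelSucc i),
        weightPr X pp.1 (Setting.labelSucc i) e * (-(m e * Real.log pp) +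
          packetLogμ pp.1 ((presAt X hlog pp).kk e)
            (packetHull pp.1 ((presAt X hlog pp).kk e)
              (logPacket pp.1 ((presAt X hlog pp).kk e) : Set ((presAt X hlog pp).X e)))) := by
  haveI : Fact (pp : ℕ).Prime := ⟨pp.2⟩
  refine thetaLocal_settingPrVol_untopD_le_sum_content_hull X hlog M archPk archSub Ψ act Mmod region n lat sig split qData
    (fun _ => qCentreDH X hlog tq) (qCentreDH_ne_zero X hlog tq htq0)
    (finite_support_logvol_qRegion_Pr X hlog M archPk archSub Ψ act Mmod region n tq htq0 htq1) (sharpBoxDH X hlog t)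
    (bridgeHyps_settingPrVolSharp_of_ideles X hlog M archPk archSub Ψ act Mmod region n lat sig split qData t tq ht0 ht1
      htq0 htq1) i pp m hm fun e => ?_
  show iota pp.1 ((presAt X hlog pp).kk e) (Fin.last _) (labelIdele X t pp (Setting.labelSucc i) (e (Fin.last _))) •
      (normalizedPacket pp.1 ((presAt X hlog pp).kk e) : Set ((presAt X hlog pp).X e)) ⊆ _
  rw [labelIdele_labelSucc]
  exact hslot e (Fin.last _)

/-! ## §3. Units (V) + (R): the global bound -/

/-- **`−|log(Θ)| ≤ ↑(Σ_{p∈T} (1/ℓ⋆)·Σ_i Σ_{v⃗∈𝕍(F)_p^{i+2}} Pr(v⃗)·(−m_{p,i}(v⃗)·log p + log μ̄_{v⃗}(hull(log_p(R_{v⃗}^×)))) + A)`** at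
`settingPrVolSharp`, for ANY finite set `T` of primes containing the prime divisors of `2·disc(F)` and the primes under `S`, ANY
capsule-symmetric content family `m` on `T` with the slot containment, ANY `A ≥ 0`: off `T` the local Θ-term VANISHES (unit boxes at
odd unramified primes, [IUTchIV] Thm. 1.10 Step (vi), abc-iut-c312-7 `thetaLocal_settingPrVol_eq_zero`), at `∞` it vanishes (§1), on `T`
it is bounded by §2, and abc-iut-w5-d166's reduction `negLogTheta_le_sum_add` swaps the procession average with the prime sum (Step
(viii)). The shape is abc-iut-S2's `ThetaVolumeInput.negLogTheta = Σ_{p∈T(I)} negLogThetaAt + archLogTheta` read through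
abc-iut-c312-3's `negLogThetaDH_ofInput_eq_of_content`. [cite: Mochizuki2012, IUTchIV Thm. 1.10 Steps (v)–(viii) p. 27–30] -/
theorem negLogTheta_settingPrVolSharp_le_sum_content_hull (ht0 : ∀ pp i x, t pp i x ≠ 0)
    (ht1 : ∀ (pp : Nat.Primes) (i : Fin X.lstar) (x : (thetaIndex X).Fibre (.inr pp)),
      haveI : Fact (pp : ℕ).Prime := ⟨pp.2⟩; placeOf X pp.1 x ∉ X.S → ‖t pp i x‖ = 1)
    (htq0 : ∀ pp x, tq pp x ≠ 0)
    (htq1 : ∀ (pp : Nat.Primes) (x : (thetaIndex X).Fibre (.inr pp)),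
      haveI : Fact (pp : ℕ).Prime := ⟨pp.2⟩; placeOf X pp.1 x ∉ X.S → ‖tq pp x‖ = 1)
    (Tp : Finset Nat.Primes)
    (hT : ∀ pp : Nat.Primes,
      ((pp : ℕ) ∣ 2 * (NumberField.discr F).natAbs ∨ ∃ v ∈ X.S, ((pp : ℕ) : 𝓞 F) ∈ v.asIdeal) → pp ∈ Tp)
    (m : ∀ (pp : Nat.Primes) (i : Fin (thetaIndex X).lstar),
      ((thetaIndex X).Caps (Setting.labelSucc i) → (thetaIndex X).Fibre (.inr pp)) → ℤ)
    (hm : ∀ (pp : Nat.Primes) (i : Fin (thetaIndex X).lstar)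
      (σ : Equiv.Perm ((thetaIndex X).Caps (Setting.labelSucc i)))
      (e : (thetaIndex X).Caps (Setting.labelSucc i) → (thetaIndex X).Fibre (.inr pp)), m pp i (e ∘ σ) = m pp i e)
    (hslot : ∀ pp ∈ Tp, ∀ (i : Fin (thetaIndex X).lstar)
      (e : (thetaIndex X).Caps (Setting.labelSucc i) → (thetaIndex X).Fibre (.inr pp))
      (a : (thetaIndex X).Caps (Setting.labelSucc i)),
      haveI : Fact (pp : ℕ).Prime := ⟨pp.2⟩
      iota pp.1 ((presAt X hlog pp).kk e) a (t pp i (e a)) •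
          (normalizedPacket pp.1 ((presAt X hlog pp).kk e) : Set ((presAt X hlog pp).X e)) ⊆
        (((pp : ℕ) : ℚ_[pp]) ^ m pp i e) • (logPacket pp.1 ((presAt X hlog pp).kk e) : Set ((presAt X hlog pp).X e)))
    {A : ℝ} (hA : 0 ≤ A) :
    (settingPrVolSharp X hlog M archPk archSub Ψ act Mmod region n lat sig split qData tq t htq0 htq1).negLogTheta ≤
      ((∑ pp ∈ Tp, (1 / ((thetaIndex X).lstar : ℝ)) * ∑ i : Fin (thetaIndex X).lstar,
          (haveI : Fact (pp : ℕ).Prime := ⟨pp.2⟩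
           ∑ e : (presAt X hlog pp).toLocalPieces.E (Setting.labelSucc i),
            weightPr X pp.1 (Setting.labelSucc i) e * (-(m pp i e * Real.log pp) +
              packetLogμ pp.1 ((presAt X hlog pp).kk e)
                (packetHull pp.1 ((presAt X hlog pp).kk e)
                  (logPacket pp.1 ((presAt X hlog pp).kk e) : Set ((presAt X hlog pp).X e))))) + A : ℝ) :
        WithTop ℝ) := by
  haveI : DecidableEq (thetaIndex X).VQ := inferInstanceAs (DecidableEq (Unit ⊕ Nat.Primes))
  -- the local bounds, as a function on all places of `ℚ` (`0` at `∞`)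
  let b : Fin (thetaIndex X).lstar → (thetaIndex X).VQ → ℝ := fun i vQ =>
    match vQ with
    | .inl _ => 0
    | .inr pp =>
      haveI : Fact (pp : ℕ).Prime := ⟨pp.2⟩
      ∑ e : (presAt X hlog pp).toLocalPieces.E (Setting.labelSucc i),
        weightPr X pp.1 (Setting.labelSucc i) e * (-(m pp i e * Real.log pp) +
          packetLogμ pp.1 ((presAt X hlog pp).kk e)
            (packetHull pp.1 ((presAt X hlog pp).kk e)
              (logPacket pp.1 ((presAt X hlog pp).kk e) : Set ((presAt X hlog pp).X e))))
  have H := bridgeHyps_settingPrVolSharp_of_ideles X hlog M archPk archSub Ψ act Mmod region n lat sig split qData t tq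
    ht0 ht1 htq0 htq1
  have hzero : ∀ (i : Fin (thetaIndex X).lstar) (vQ : (thetaIndex X).VQ),
      vQ ∉ (Tp.image Sum.inr : Finset (thetaIndex X).VQ) →
      (settingPrVolSharp X hlog M archPk archSub Ψ act Mmod region n lat sig split qData tq t htq0 htq1).thetaLocal
        (Setting.labelSucc i) vQ = ((0 : ℝ) : WithTop ℝ) := by
    intro i vQ hvQ
    rcases vQ with u | pp
    · exact thetaLocal_settingPrVol_inl_eq_zero X hlog M archPk archSub Ψ act Mmod region n lat sig split qData
        (fun _ _ => thetaBoxDH X hlog (sharpBoxDH X hlog t)) (fun _ => qCentreDH X hlog tq) (qCentreDH_ne_zero X hlog tq htq0)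
        (finite_support_logvol_qRegion_Pr X hlog M archPk archSub Ψ act Mmod region n tq htq0 htq1) (Setting.labelSucc i) u
    · haveI : Fact (pp : ℕ).Prime := ⟨pp.2⟩
      have hpp : pp ∉ Tp := fun h => hvQ (Finset.mem_image_of_mem _ h)
      have hgood : ¬ ((pp : ℕ) ∣ 2 * (NumberField.discr F).natAbs) := fun h => hpp (hT pp (Or.inl h))
      have hnotS : ¬ ∃ v ∈ X.S, ((pp : ℕ) : 𝓞 F) ∈ v.asIdeal := fun h => hpp (hT pp (Or.inr h))
      obtain ⟨hp2, hdisc⟩ := good_of_not_dvd (F := F) pp hgood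
      have h1 : ∀ x : (thetaIndex X).Fibre (.inr pp), ‖t pp i x‖ = 1 :=
        fun x => ht1 pp i x fun hS => hnotS ⟨_, hS, natCast_mem_placeOf X pp.1 x⟩
      refine thetaLocal_settingPrVol_eq_zero X hlog M archPk archSub Ψ act Mmod region n lat sig split qData
        (fun _ _ => thetaBoxDH X hlog (sharpBoxDH X hlog t)) (fun _ => qCentreDH X hlog tq) (qCentreDH_ne_zero X hlog tq htq0)
        (finite_support_logvol_qRegion_Pr X hlog M archPk archSub Ψ act Mmod region n tq htq0 htq1) i pp hp2 hdisc ?_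
      rw [iUnion_thetaBoxDH_sharp]
      exact thetaBoxDH_sharp_eq_hullSet_one X hlog t ht0 i pp h1
  have hle : ∀ (i : Fin (thetaIndex X).lstar), ∀ vQ ∈ (Tp.image Sum.inr : Finset (thetaIndex X).VQ),
      (settingPrVolSharp X hlog M archPk archSub Ψ act Mmod region n lat sig split qData tq t htq0 htq1).thetaLocal
        (Setting.labelSucc i) vQ ≤ ((b i vQ : ℝ) : WithTop ℝ) := by
    intro i vQ hvQ
    obtain ⟨pp, hpp, rfl⟩ := Finset.mem_image.mp hvQ
    exact thetaLocal_le_coe_of_untopD_le H i _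
      (thetaLocal_settingPrVolSharp_untopD_le_sum_content_hull X hlog M archPk archSub Ψ act Mmod region n lat sig split
        qData t tq ht0 ht1 htq0 htq1 i pp (m pp i) (hm pp i) (hslot pp hpp i))
  have key := (settingPrVolSharp X hlog M archPk archSub Ψ act Mmod region n lat sig split qData tq t htq0
    htq1).negLogTheta_le_sum_add (Tp.image Sum.inr : Finset (thetaIndex X).VQ) b hA hzero hle
  have hsum : ∑ vQ ∈ (Tp.image Sum.inr : Finset (thetaIndex X).VQ), (1 / ((thetaIndex X).lstar : ℝ)) *
      ∑ i : Fin (thetaIndex X).lstar, b i vQ =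
      ∑ pp ∈ Tp, (1 / ((thetaIndex X).lstar : ℝ)) * ∑ i : Fin (thetaIndex X).lstar, b i (.inr pp) :=
    Finset.sum_image fun x _ y _ h => Sum.inr_injective h
  rw [hsum] at key
  exact key

end Sharp

end Real

end Thm311

end IUTFork

end Summit.ABC

end
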